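import Summits.HubbardSuperconductivity.HubbardSuperconductivity.Theorems.AnisotropyChordTransferFibre3FinX3Eval

/-!
# Route `AnisotropyChord` / H0 rotor rung: FIN per-`L` GM₃ (X4), `L = 25` — rows `N₁` / D / side-condition cell facts, part `p33`

Kernel facts (`decide +kernel`) for cert cells 85, 86 of the per-`L` grid of `L = 25`: `xbnCellAny2` (row `N₁` on XB2 point wedges recomputed in the kernel, exporting the literal brackets `nt ⊇ T⁺ − 3λ₂` and `tb ⊇ T⁺·D`), `xdCellAnyN0` (row D, reads `nt`), `sdCellAnyZN` (side condition, reads `nt`); evaluators `…FinX3Eval`; constants from the compiled design probe (x3probe/x3plan, margins c ×0.985, b ×1.03, aD ×1.03); assembled in `…FinX3GM3TwentyFive`.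
Prover seat `hubbard-h0-rotor-p3` g8; helper for piece A = stmt-HubbardSuperconductivity-23918 of rung 19089 (`--supports`, helper class).
WHAT THIS IS NOT: nothing here proves superconductivity in the Hubbard model (rotor TARGET as worded stays FALSE, g15 verdict); kernel facts for the FIN certificate of ONE conditional reduction.  Tree imports only; zero data; standard axioms.
-/

set_option linter.dupNamespace false
set_option autoImplicit false

namespace Summit.HubbardSuperconductivity.HubbardSuperconductivity.Theorems.AnisotropyChord.Transfer.Fibre3

namespace FinXD

open FinXB FinCell Hole2

set_option maxHeartbeats 4000000 in
/-- row `N₁` of cell 85 of `L = 25` (`c = 3/5`), exporting `nt`, `tb`. [folklore] -/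
theorem xn25_85 : xbnCellAny2 25 (49/50 : ℚ) 698656643095116 716123059172494 (3/5 : ℚ) ((-1268188456644 : ℤ), (6222127073451 : ℤ)) ((2094688948043491 : ℤ), (2154604097376146 : ℤ)) = true := by decide +kernel

set_option maxHeartbeats 4000000 in
/-- row D of cell 85 of `L = 25` (`aD = 2/25`). [folklore] -/
theorem xd25_85 : xdCellAnyN0 25 (49/50 : ℚ) 698656643095116 716123059172494 (2/25 : ℚ) ((-1268188456644 : ℤ), (6222127073451 : ℤ)) = true := by decide +kernel

set_option maxHeartbeats 4000000 in
/-- side condition of cell 85 of `L = 25` (`c, b = 66/100, aD`). [folklore] -/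
theorem sd25_85 : sdCellAnyZN 25 (49/50 : ℚ) 100 698656643095116 716123059172494 ((3/5 : ℚ), (66 : ℕ), (2/25 : ℚ)) ((-1268188456644 : ℤ), (6222127073451 : ℤ)) = true := by decide +kernel

set_option maxHeartbeats 4000000 in
/-- row `N₁` of cell 86 of `L = 25` (`c = 3/5`), exporting `nt`, `tb`. [folklore] -/
theorem xn25_86 : xbnCellAny2 25 (49/50 : ℚ) 716123059172494 734026135651807 (3/5 : ℚ) ((-1099645029812 : ℤ), (6401367703401 : ℤ)) ((2147256419882826 : ℤ), (2208492887263666 : ℤ)) = true := by decide +kernel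

set_option maxHeartbeats 4000000 in
/-- row D of cell 86 of `L = 25` (`aD = 2/25`). [folklore] -/
theorem xd25_86 : xdCellAnyN0 25 (49/50 : ℚ) 716123059172494 734026135651807 (2/25 : ℚ) ((-1099645029812 : ℤ), (6401367703401 : ℤ)) = true := by decide +kernel

set_option maxHeartbeats 4000000 in
/-- side condition of cell 86 of `L = 25` (`c, b = 67/100, aD`). [folklore] -/
theorem sd25_86 : sdCellAnyZN 25 (49/50 : ℚ) 100 716123059172494 734026135651807 ((3/5 : ℚ), (67 : ℕ), (2/25 : ℚ)) ((-1099645029812 : ℤ), (6401367703401 : ℤ)) = true := by decide +kernel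

end FinXD

end Summit.HubbardSuperconductivity.HubbardSuperconductivity.Theorems.AnisotropyChord.Transfer.Fibre3
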